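import Literature.Computability.Complexity.GraphCanonizationProgramFPRefiner
import Literature.Computability.Complexity.GraphCanonizationProgramMachine
import Literature.Computability.Complexity.CodeFPStringKit
import HarnessLib

/-!
# The canoniser as a list program is typed polynomial time, III: switch bits, components, parts, codes

`CodeFP` certificates for the section-step ingredients of the canoniser on lists
(`GraphCanonizationProgramData.lean`, `…ProgramParts.lean`, `…ProgramMachine.lean`), on the context
`((1ⁿ, rows, mask), colours)` (`CGProg.ctxE`):

* `codeFP_cellCardL`, `codeFP_crossL`, `codeFP_switchL`, `codeFP_swAdjL`, `codeFP_swEdgesL` —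
  the switched graph of a state [Laubner2011, Def. 3.3.2];
* `codeFP_labelsL` (through `MinLabel.codeFP_minLabels`), `codeFP_compMaskL`, `codeFP_isConnL`,
  `codeFP_wlistL`, `codeFP_partsL` (through `CodeFP.dedup`);
* `codeFP_codeL` — the code of an ordering; `codeFP_bigMinCellL` — the branching cell.

## References

* S. Arora, B. Barak, *Computational Complexity: A Modern Approach*, CUP 2009, §1.3. [AroraBarakCC2009]
* B. Laubner, PhD thesis, HU Berlin 2011, doi:10.18452/16335, Def. 3.3.2, §3.4. [Laubner2011]
-/

namespace Literature.Computability.Complexity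

open _root_.Computability CodeFP Polynomial

namespace CGProg

/-! ### Switch bits and the switched graph -/

/-- Class sizes are typed polynomial time: input `((1ⁿ, colours), a)`. [cite: AroraBarakCC2009, §1.3] -/
theorem codeFP_cellCardL : CodeFP (pairE (pairE unE (rawE natE)) natE) natE (fun p => cellCardL p.1.1 p.1.2 p.2) := by
  let κ : ((ℕ × List ℕ) × ℕ) × ℕ → List Bool := pairE (pairE (pairE unE (rawE natE)) natE) natE
  have hcol : CodeFP κ (rawE natE) (fun t => t.1.1.2) := (fst _ _).fst'.snd'
  have ha : CodeFP κ natE (fun t => t.1.2) := (fst _ _).snd'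
  have hw : CodeFP κ natE (fun t => t.2) := snd _ _
  have hpred : CodeFP κ bitE (fun t => decide (natAt t.1.1.2 t.2 = t.1.2)) := (natEq.comp ((codeFP_natAt.comp (hcol.pair hw)).pair ha)).congr fun _ => rfl
  have hr : CodeFP (pairE (pairE unE (rawE natE)) natE) (rawE natE) (fun p => List.range p.1.1) := urange.comp (fst _ _).fst'
  exact ((natLength natE).comp ((filter hpred).comp ((CodeFP.id _).pair hr))).congr fun _ => rfl

/-- Cross-edge counts are typed polynomial time: input `(ctx, (a, b))`. [cite: AroraBarakCC2009, §1.3] -/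
theorem codeFP_crossL : CodeFP (pairE ctxE (pairE natE natE)) natE (fun t => crossL t.1.1.1 t.1.1.2.1 t.1.1.2.2 t.1.2 t.2.1 t.2.2) := by
  let κ : (Ctx × (ℕ × ℕ)) × (ℕ × ℕ) → List Bool := pairE (pairE ctxE (pairE natE natE)) (pairE natE natE)
  have hA : CodeFP κ (rawE strE) (fun t => t.1.1.1.2.1) := (fst _ _).fst'.fst'.snd'.fst'
  have hm : CodeFP κ strE (fun t => t.1.1.1.2.2) := (fst _ _).fst'.fst'.snd'.snd'
  have hcol : CodeFP κ (rawE natE) (fun t => t.1.1.2) := (fst _ _).fst'.snd'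
  have ha : CodeFP κ natE (fun t => t.1.2.1) := (fst _ _).snd'.fst'
  have hb : CodeFP κ natE (fun t => t.1.2.2) := (fst _ _).snd'.snd'
  have hp1 : CodeFP κ natE (fun t => t.2.1) := (snd _ _).fst'
  have hp2 : CodeFP κ natE (fun t => t.2.2) := (snd _ _).snd'
  have h1 : CodeFP κ bitE (fun t => decide (natAt t.1.1.2 t.2.1 = t.1.2.1)) := (natEq.comp ((codeFP_natAt.comp (hcol.pair hp1)).pair ha)).congr fun _ => rfl
  have h2 : CodeFP κ bitE (fun t => decide (natAt t.1.1.2 t.2.2 = t.1.2.2)) := (natEq.comp ((codeFP_natAt.comp (hcol.pair hp2)).pair hb)).congr fun _ => rfl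
  have h3 : CodeFP κ bitE (fun t => adjW t.1.1.1.2.1 t.1.1.1.2.2 t.2.1 t.2.2) := (codeFP_adjW.comp ((hA.pair hm).pair (hp1.pair hp2))).congr fun _ => rfl
  have hpred : CodeFP κ bitE (fun t => decide (natAt t.1.1.2 t.2.1 = t.1.2.1) && decide (natAt t.1.1.2 t.2.2 = t.1.2.2) && adjW t.1.1.1.2.1 t.1.1.1.2.2 t.2.1 t.2.2) :=
    (h1.and h2).and h3
  have hn : CodeFP (pairE ctxE (pairE natE natE)) unE (fun s => s.1.1.1) := (fst _ _).fst'.fst'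
  have hr : CodeFP (pairE ctxE (pairE natE natE)) (rawE natE) (fun s => List.range s.1.1.1) := urange.comp hn
  have hprod : CodeFP (pairE ctxE (pairE natE natE)) (rawE (pairE natE natE)) (fun s => (List.range s.1.1.1).product (List.range s.1.1.1)) :=
    (rawProduct natE natE).comp (hr.pair hr)
  exact ((natLength (pairE natE natE)).comp ((filter hpred).comp ((CodeFP.id _).pair hprod))).congr fun _ => rfl

/-- Switch bits are typed polynomial time: input `(ctx, (a, b))`. [cite: Laubner2011, Def. 3.3.2] -/
theorem codeFP_switchL : CodeFP (pairE ctxE (pairE natE natE)) bitE (fun t => switchL t.1.1.1 t.1.1.2.1 t.1.1.2.2 t.1.2 t.2.1 t.2.2) := by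
  have hn : CodeFP (pairE ctxE (pairE natE natE)) unE (fun s => s.1.1.1) := (fst _ _).fst'.fst'
  have hcol : CodeFP (pairE ctxE (pairE natE natE)) (rawE natE) (fun s => s.1.2) := (fst _ _).snd'
  have ha : CodeFP (pairE ctxE (pairE natE natE)) natE (fun s => s.2.1) := (snd _ _).fst'
  have hb : CodeFP (pairE ctxE (pairE natE natE)) natE (fun s => s.2.2) := (snd _ _).snd'
  have hca : CodeFP (pairE ctxE (pairE natE natE)) natE (fun s => cellCardL s.1.1.1 s.1.2 s.2.1) := (codeFP_cellCardL.comp ((hn.pair hcol).pair ha)).congr fun _ => rfl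
  have hcb : CodeFP (pairE ctxE (pairE natE natE)) natE (fun s => cellCardL s.1.1.1 s.1.2 s.2.2) := (codeFP_cellCardL.comp ((hn.pair hcol).pair hb)).congr fun _ => rfl
  have hlhs : CodeFP (pairE ctxE (pairE natE natE)) natE (fun s => cellCardL s.1.1.1 s.1.2 s.2.1 * cellCardL s.1.1.1 s.1.2 s.2.2) := natMul.comp (hca.pair hcb)
  have hrhs : CodeFP (pairE ctxE (pairE natE natE)) natE (fun s => 2 * crossL s.1.1.1 s.1.1.2.1 s.1.1.2.2 s.1.2 s.2.1 s.2.2) :=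
    (natMul.comp ((const _ 2).pair codeFP_crossL)).congr fun _ => rfl
  exact (natLt.comp (hlhs.pair hrhs)).congr fun _ => rfl

/-- Switched adjacency is typed polynomial time: input `(ctx, (u, v))`. [cite: Laubner2011, Def. 3.3.2] -/
theorem codeFP_swAdjL : CodeFP (pairE ctxE (pairE natE natE)) bitE (fun t => swAdjL t.1.1.1 t.1.1.2.1 t.1.1.2.2 t.1.2 t.2.1 t.2.2) := by
  let κ : Ctx × (ℕ × ℕ) → List Bool := pairE ctxE (pairE natE natE)
  have hA : CodeFP κ (rawE strE) (fun t => t.1.1.2.1) := (fst _ _).fst'.snd'.fst'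
  have hm : CodeFP κ strE (fun t => t.1.1.2.2) := (fst _ _).fst'.snd'.snd'
  have hcol : CodeFP κ (rawE natE) (fun t => t.1.2) := (fst _ _).snd'
  have hu : CodeFP κ natE (fun t => t.2.1) := (snd _ _).fst'
  have hv : CodeFP κ natE (fun t => t.2.2) := (snd _ _).snd'
  have heq : CodeFP κ bitE (fun t => decide (t.2.1 = t.2.2)) := natEq.comp (hu.pair hv)
  have hadj : CodeFP κ bitE (fun t => adjW t.1.1.2.1 t.1.1.2.2 t.2.1 t.2.2) := (codeFP_adjW.comp ((hA.pair hm).pair (hu.pair hv))).congr fun _ => rfl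
  have hcu : CodeFP κ natE (fun t => natAt t.1.2 t.2.1) := (codeFP_natAt.comp (hcol.pair hu)).congr fun _ => rfl
  have hcv : CodeFP κ natE (fun t => natAt t.1.2 t.2.2) := (codeFP_natAt.comp (hcol.pair hv)).congr fun _ => rfl
  have hsw : CodeFP κ bitE (fun t => switchL t.1.1.1 t.1.1.2.1 t.1.1.2.2 t.1.2 (natAt t.1.2 t.2.1) (natAt t.1.2 t.2.2)) :=
    (codeFP_switchL.comp ((fst _ _).pair (hcu.pair hcv))).congr fun _ => rfl
  have hbe : CodeFP κ bitE (fun t => decide (adjW t.1.1.2.1 t.1.1.2.2 t.2.1 t.2.2 = !switchL t.1.1.1 t.1.1.2.1 t.1.1.2.2 t.1.2 (natAt t.1.2 t.2.1) (natAt t.1.2 t.2.2))) :=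
    (eq bitE_injective).comp (hadj.pair hsw.not)
  exact (heq.not.and hbe).congr fun _ => rfl

/-- The context with the colours replaced by their lift. [folklore] -/
theorem codeFP_liftCtx : CodeFP ctxE ctxE (fun s => (s.1, liftL s.1.2.2 s.2)) :=
  (fst _ _).pair ((codeFP_liftL.comp ((fst _ _).snd'.snd'.pair (snd _ _))).congr fun _ => rfl)

/-- **The edge list of the switched graph is typed polynomial time.** [cite: Laubner2011, Def. 3.3.2] -/
theorem codeFP_swEdgesL : CodeFP ctxE (rawE (pairE natE natE)) (fun s => swEdgesL s.1.1 s.1.2.1 s.1.2.2 s.2) := by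
  have hn : CodeFP ctxE unE (fun s => s.1.1) := (fst _ _).fst'
  have hr : CodeFP ctxE (rawE natE) (fun s => List.range s.1.1) := urange.comp hn
  have hprod : CodeFP ctxE (rawE (pairE natE natE)) (fun s => (List.range s.1.1).product (List.range s.1.1)) := (rawProduct natE natE).comp (hr.pair hr)
  have hpred : CodeFP (pairE ctxE (pairE natE natE)) bitE (fun t => swAdjL t.1.1.1 t.1.1.2.1 t.1.1.2.2 (liftL t.1.1.2.2 t.1.2) t.2.1 t.2.2) :=
    (codeFP_swAdjL.comp ((codeFP_liftCtx.comp (fst _ _)).pair (snd _ _))).congr fun _ => rfl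
  exact ((filter hpred).comp ((CodeFP.id _).pair hprod)).congr fun _ => rfl

/-! ### Labels, components, connectivity, parts -/

/-- **The component labels are typed polynomial time.** [cite: AroraBarakCC2009, §1.3] -/
theorem codeFP_labelsL : CodeFP ctxE (rawE natE) (fun s => labelsL s.1.1 s.1.2.1 s.1.2.2 s.2) :=
  (MinLabel.codeFP_minLabels.comp (codeFP_swEdgesL.pair (fst _ _).fst')).congr fun _ => rfl

/-- The context with its labels: `(ctx, labels)`. [folklore] -/
abbrev LCtx : Type := Ctx × List ℕ

/-- Component masks are typed polynomial time: input `((ctx, labels), u)` (the labels precomputed). [cite: AroraBarakCC2009, §1.3] -/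
theorem codeFP_compMaskL' : CodeFP (pairE (pairE ctxE (rawE natE)) natE) strE
    (fun t => (List.range t.1.1.1.1).map fun v => bitAt t.1.1.1.2.2 v && decide (natAt t.1.2 v = natAt t.1.2 t.2)) := by
  let κ : ((Ctx × List ℕ) × ℕ) × ℕ → List Bool := pairE (pairE (pairE ctxE (rawE natE)) natE) natE
  have hm : CodeFP κ strE (fun t => t.1.1.1.1.2.2) := (fst _ _).fst'.fst'.fst'.snd'.snd'
  have hlab : CodeFP κ (rawE natE) (fun t => t.1.1.2) := (fst _ _).fst'.snd'
  have hu : CodeFP κ natE (fun t => t.1.2) := (fst _ _).snd'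
  have hv : CodeFP κ natE (fun t => t.2) := snd _ _
  have hbit : CodeFP κ bitE (fun t => bitAt t.1.1.1.1.2.2 t.2) := (codeFP_bitAt.comp (hm.pair hv)).congr fun _ => rfl
  have heq : CodeFP κ bitE (fun t => decide (natAt t.1.1.2 t.2 = natAt t.1.1.2 t.1.2)) :=
    (natEq.comp ((codeFP_natAt.comp (hlab.pair hv)).pair (codeFP_natAt.comp (hlab.pair hu)))).congr fun _ => rfl
  have hn : CodeFP (pairE (pairE ctxE (rawE natE)) natE) unE (fun t => t.1.1.1.1) := (fst _ _).fst'.fst'.fst'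
  have hr : CodeFP (pairE (pairE ctxE (rawE natE)) natE) (rawE natE) (fun t => List.range t.1.1.1.1) := urange.comp hn
  exact (bitsToStr.comp ((map (hbit.and heq)).comp ((CodeFP.id _).pair hr))).congr fun _ => rfl

/-- **Component masks are typed polynomial time**: input `(ctx, u)`. [cite: Laubner2011, Prop. 3.3.4] -/
theorem codeFP_compMaskL : CodeFP (pairE ctxE natE) strE (fun t => compMaskL t.1.1.1 t.1.1.2.1 t.1.1.2.2 t.1.2 t.2) :=
  (codeFP_compMaskL'.comp (((fst _ _).pair (codeFP_labelsL.comp (fst _ _))).pair (snd _ _))).congr fun _ => rfl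

/-- **Connectivity is typed polynomial time.** [cite: Laubner2011, §3.4] -/
theorem codeFP_isConnL : CodeFP ctxE bitE (fun s => isConnL s.1.1 s.1.2.1 s.1.2.2 s.2) := by
  -- on `(ctx, labels)`: all `u`, all `v`
  let κ₂ : ((Ctx × List ℕ) × ℕ) × ℕ → List Bool := pairE (pairE (pairE ctxE (rawE natE)) natE) natE
  have hm : CodeFP κ₂ strE (fun t => t.1.1.1.1.2.2) := (fst _ _).fst'.fst'.fst'.snd'.snd'
  have hlab : CodeFP κ₂ (rawE natE) (fun t => t.1.1.2) := (fst _ _).fst'.snd'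
  have hu : CodeFP κ₂ natE (fun t => t.1.2) := (fst _ _).snd'
  have hv : CodeFP κ₂ natE (fun t => t.2) := snd _ _
  have hbu : CodeFP κ₂ bitE (fun t => bitAt t.1.1.1.1.2.2 t.1.2) := (codeFP_bitAt.comp (hm.pair hu)).congr fun _ => rfl
  have hbv : CodeFP κ₂ bitE (fun t => bitAt t.1.1.1.1.2.2 t.2) := (codeFP_bitAt.comp (hm.pair hv)).congr fun _ => rfl
  have heq : CodeFP κ₂ bitE (fun t => decide (natAt t.1.1.2 t.1.2 = natAt t.1.1.2 t.2)) :=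
    (natEq.comp ((codeFP_natAt.comp (hlab.pair hu)).pair (codeFP_natAt.comp (hlab.pair hv)))).congr fun _ => rfl
  have hinner : CodeFP κ₂ bitE (fun t => !(bitAt t.1.1.1.1.2.2 t.1.2 && bitAt t.1.1.1.1.2.2 t.2) || decide (natAt t.1.1.2 t.1.2 = natAt t.1.1.2 t.2)) :=
    (hbu.and hbv).not.or heq
  have hn1 : CodeFP (pairE (pairE ctxE (rawE natE)) natE) unE (fun t => t.1.1.1.1) := (fst _ _).fst'.fst'.fst'
  have hr1 : CodeFP (pairE (pairE ctxE (rawE natE)) natE) (rawE natE) (fun t => List.range t.1.1.1.1) := urange.comp hn1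
  have hall1 := (all hinner).comp ((CodeFP.id _).pair hr1)
  have hn0 : CodeFP (pairE ctxE (rawE natE)) unE (fun t => t.1.1.1) := (fst _ _).fst'.fst'
  have hr0 : CodeFP (pairE ctxE (rawE natE)) (rawE natE) (fun t => List.range t.1.1.1) := urange.comp hn0
  have hall0 : CodeFP (pairE ctxE (rawE natE)) bitE (fun t => (List.range t.1.1.1).all fun u => (List.range t.1.1.1).all fun v =>
      !(bitAt t.1.1.2.2 u && bitAt t.1.1.2.2 v) || decide (natAt t.2 u = natAt t.2 v)) := ((all hall1).comp ((CodeFP.id _).pair hr0)).congr fun _ => rfl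
  exact (hall0.comp ((CodeFP.id _).pair codeFP_labelsL)).congr fun _ => rfl

/-- **The sorted vertex list of a mask is typed polynomial time.** [cite: AroraBarakCC2009, §1.3] -/
theorem codeFP_wlistL : CodeFP strE (rawE natE) wlistL := by
  have hpred : CodeFP (pairE strE natE) bitE (fun t => bitAt t.1 t.2) := codeFP_bitAt
  have hr : CodeFP strE (rawE natE) (fun m => List.range m.length) := urange.comp strLength
  exact ((filter hpred).comp ((CodeFP.id _).pair hr)).congr fun _ => rfl

/-- **The parts are typed polynomial time.** [cite: Laubner2011, §3.4 step 2] -/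
theorem codeFP_partsL : CodeFP ctxE (rawE strE) (fun s => partsL s.1.1 s.1.2.1 s.1.2.2 s.2) := by
  have hitem : CodeFP (pairE (pairE ctxE (rawE natE)) natE) strE (fun t => (List.range t.1.1.1.1).map fun v =>
      bitAt t.1.1.1.2.2 v && decide (natAt t.1.2 v = natAt t.1.2 t.2)) := codeFP_compMaskL'
  have hw : CodeFP (pairE ctxE (rawE natE)) (rawE natE) (fun t => wlistL t.1.1.2.2) := codeFP_wlistL.comp (fst _ _).fst'.snd'.snd'
  have hmap := (map hitem).comp ((CodeFP.id _).pair hw)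
  have hd := (dedup strE (fun a b h => h)).comp hmap
  refine (hd.comp ((CodeFP.id _).pair codeFP_labelsL)).congr fun s => ?_
  rfl

/-! ### Codes of orderings and the branching cell -/

/-- **The code of an ordering is typed polynomial time**: input `((rows, colours), ord)`. [cite: Laubner2011, Thm. 3.4.3] -/
theorem codeFP_codeL : CodeFP (pairE (pairE (rawE strE) (rawE natE)) (rawE natE)) (pairE (rawE strE) (rawE natE)) (fun p => codeL p.1.1 p.1.2 p.2) := by
  let κ : ((List (List Bool) × List ℕ) × List ℕ) → List Bool := pairE (pairE (rawE strE) (rawE natE)) (rawE natE)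
  -- rows: context `(p, u)`, item `v`
  have hA2 : CodeFP (pairE (pairE κ natE) natE) (rawE strE) (fun t => t.1.1.1.1) := (fst _ _).fst'.fst'.fst'
  have hu2 : CodeFP (pairE (pairE κ natE) natE) natE (fun t => t.1.2) := (fst _ _).snd'
  have hv2 : CodeFP (pairE (pairE κ natE) natE) natE (fun t => t.2) := snd _ _
  have hbit : CodeFP (pairE (pairE κ natE) natE) bitE (fun t => adjAt t.1.1.1.1 t.1.2 t.2) := (codeFP_adjAt.comp (hA2.pair (hu2.pair hv2))).congr fun _ => rfl
  have hord1 : CodeFP (pairE κ natE) (rawE natE) (fun t => t.1.2) := (fst _ _).snd'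
  have hrow : CodeFP (pairE κ natE) strE (fun t => t.1.2.map fun v => adjAt t.1.1.1 t.2 v) :=
    (bitsToStr.comp ((map hbit).comp ((CodeFP.id _).pair hord1))).congr fun _ => rfl
  have hrows : CodeFP κ (rawE strE) (fun p => p.2.map fun u => p.2.map fun v => adjAt p.1.1 u v) :=
    ((map hrow).comp ((CodeFP.id _).pair (snd _ _))).congr fun _ => rfl
  -- colours
  have hcol1 : CodeFP (pairE κ natE) natE (fun t => natAt t.1.1.2 t.2) := (codeFP_natAt.comp ((fst _ _).fst'.snd'.pair (snd _ _))).congr fun _ => rfl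
  have hcols : CodeFP κ (rawE natE) (fun p => p.2.map fun u => natAt p.1.2 u) := ((map hcol1).comp ((CodeFP.id _).pair (snd _ _))).congr fun _ => rfl
  exact (hrows.pair hcols).congr fun _ => rfl

/-- Lexicographic comparison of pairs of numerals, as a Boolean. [folklore] -/
theorem decide_toLex_le (a b c d : ℕ) : decide (toLex (a, b) ≤ toLex (c, d)) = (decide (a < c) || (decide (a = c) && decide (b ≤ d))) := by
  rw [Bool.eq_iff_iff, decide_eq_true_iff, Prod.Lex.toLex_le_toLex]
  simp only [Bool.or_eq_true, Bool.and_eq_true, decide_eq_true_iff]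

/-- **The branching cell is typed polynomial time**: input `(mask, colours)`. [cite: Laubner2011, §3.4 step 3] -/
theorem codeFP_bigMinCellL : CodeFP (pairE strE (rawE natE)) (rawE natE) (fun p => bigMinCellL p.1 p.2) := by
  -- cell sizes: context `((mask, col), w)`, filter over `wlist` by `u`
  let κ₁ : (List Bool × List ℕ) × ℕ → List Bool := pairE (pairE strE (rawE natE)) natE
  have hcolu : CodeFP (pairE κ₁ natE) bitE (fun t => decide (natAt t.1.1.2 t.2 = natAt t.1.1.2 t.1.2)) :=
    (natEq.comp ((codeFP_natAt.comp ((fst _ _).fst'.snd'.pair (snd _ _))).pair (codeFP_natAt.comp ((fst _ _).fst'.snd'.pair (fst _ _).snd')))).congr fun _ => rfl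
  have hw1 : CodeFP κ₁ (rawE natE) (fun t => wlistL t.1.1) := codeFP_wlistL.comp (fst _ _).fst'
  have hcsize : CodeFP κ₁ natE (fun t => ((wlistL t.1.1).filter fun u => decide (natAt t.1.2 u = natAt t.1.2 t.2)).length) :=
    ((natLength natE).comp ((filter hcolu).comp ((CodeFP.id _).pair hw1))).congr fun _ => rfl
  -- the test `inBigMinCellL`: context `((mask, col), v)`, all over `w`
  let κ₂ : ((List Bool × List ℕ) × ℕ) × ℕ → List Bool := pairE κ₁ natE
  have hmc2 : CodeFP κ₂ (pairE strE (rawE natE)) (fun t => t.1.1) := (fst _ _).fst'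
  have hv2 : CodeFP κ₂ natE (fun t => t.1.2) := (fst _ _).snd'
  have hw2 : CodeFP κ₂ natE (fun t => t.2) := snd _ _
  have hsv : CodeFP κ₂ natE (fun t => ((wlistL t.1.1.1).filter fun u => decide (natAt t.1.1.2 u = natAt t.1.1.2 t.1.2)).length) := (hcsize.comp (hmc2.pair hv2)).congr fun _ => rfl
  have hsw : CodeFP κ₂ natE (fun t => ((wlistL t.1.1.1).filter fun u => decide (natAt t.1.1.2 u = natAt t.1.1.2 t.2)).length) := (hcsize.comp (hmc2.pair hw2)).congr fun _ => rfl
  have hcv : CodeFP κ₂ natE (fun t => natAt t.1.1.2 t.1.2) := (codeFP_natAt.comp (hmc2.snd'.pair hv2)).congr fun _ => rfl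
  have hcw : CodeFP κ₂ natE (fun t => natAt t.1.1.2 t.2) := (codeFP_natAt.comp (hmc2.snd'.pair hw2)).congr fun _ => rfl
  have h2w : CodeFP κ₂ bitE (fun t => decide (2 ≤ ((wlistL t.1.1.1).filter fun u => decide (natAt t.1.1.2 u = natAt t.1.1.2 t.2)).length)) := natLe.comp ((const _ 2).pair hsw)
  have hlex : CodeFP κ₂ bitE (fun t => decide (((wlistL t.1.1.1).filter fun u => decide (natAt t.1.1.2 u = natAt t.1.1.2 t.1.2)).length <
      ((wlistL t.1.1.1).filter fun u => decide (natAt t.1.1.2 u = natAt t.1.1.2 t.2)).length) ||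
      (decide (((wlistL t.1.1.1).filter fun u => decide (natAt t.1.1.2 u = natAt t.1.1.2 t.1.2)).length =
        ((wlistL t.1.1.1).filter fun u => decide (natAt t.1.1.2 u = natAt t.1.1.2 t.2)).length) && decide (natAt t.1.1.2 t.1.2 ≤ natAt t.1.1.2 t.2))) :=
    (natLt.comp (hsv.pair hsw)).or ((natEq.comp (hsv.pair hsw)).and (natLe.comp (hcv.pair hcw)))
  have hinner : CodeFP κ₂ bitE (fun t => !decide (2 ≤ ((wlistL t.1.1.1).filter fun u => decide (natAt t.1.1.2 u = natAt t.1.1.2 t.2)).length) ||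
      decide (toLex (((wlistL t.1.1.1).filter fun u => decide (natAt t.1.1.2 u = natAt t.1.1.2 t.1.2)).length, natAt t.1.1.2 t.1.2) ≤
        toLex (((wlistL t.1.1.1).filter fun u => decide (natAt t.1.1.2 u = natAt t.1.1.2 t.2)).length, natAt t.1.1.2 t.2))) :=
    (h2w.not.or hlex).congr fun t => by rw [decide_toLex_le]
  have hwl1 : CodeFP κ₁ (rawE natE) (fun t => wlistL t.1.1) := hw1
  have hall := (all hinner).comp ((CodeFP.id _).pair hwl1)
  have hbit1 : CodeFP κ₁ bitE (fun t => bitAt t.1.1 t.2) := (codeFP_bitAt.comp ((fst _ _).fst'.pair (snd _ _))).congr fun _ => rfl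
  have h2v : CodeFP κ₁ bitE (fun t => decide (2 ≤ ((wlistL t.1.1).filter fun u => decide (natAt t.1.2 u = natAt t.1.2 t.2)).length)) := natLe.comp ((const _ 2).pair hcsize)
  have htest : CodeFP κ₁ bitE (fun t => inBigMinCellL t.1.1 t.1.2 t.2) := ((hbit1.and h2v).and hall).congr fun _ => rfl
  have hw0 : CodeFP (pairE strE (rawE natE)) (rawE natE) (fun p => wlistL p.1) := codeFP_wlistL.comp (fst _ _)
  exact ((filter htest).comp ((CodeFP.id _).pair hw0)).congr fun _ => rfl

end CGProg

end Literature.Computability.Complexity
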